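import Mathlib
import Literature.Algebra.Polynomial.BernoulliEulerAppell
import Literature.Combinatorics.Enumerative.GenocchiNumbers
import Literature.Combinatorics.Enumerative.EulerNumbersHyperbolicSecant
import HarnessLib

/-!
# Values of the Euler polynomials at `0`, `1/2`, `1`: Euler numbers, tangent numbers, Genocchi and Bernoulli numbers

[cite: Hoffman1999DerivativePolynomials, §1 eq. (2) («the Euler polynomials Eₙ(x), defined by 2e^{xt}/(eᵗ+1) = Σ Eₙ(x)tⁿ/n!»), §6 («the Euler numbers are Eₙ = 2ⁿEₙ(½)»; (10) «Eₙ(½) = 0, n odd; (−1)^{n/2}2^{−n}Qₙ(0), n even. Hence Qₙ(0) = |Eₙ|»; (11) «Eₙ(0) = −Eₙ(1) = 0, n even; (−1)^{(n+1)/2}2^{−n}Pₙ(0), n odd, for n ≥ 1; this can be written in terms of Bernoulli numbers as −2(2^{n+1} − 1)B_{n+1}/(n+1)»)]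

The tree's Euler polynomials are `Literature.Algebra.Polynomial.eulerPolynomial K n` (Rota's `[I + Δ/2]⁻¹xⁿ`,
characterised by `Eₙ(x+1) + Eₙ(x) = 2xⁿ` and the Appell property).  Here, over `ℚ`:

* §1 ★ the generating function at `x = 0`: `(Σ Eₙ(0)tⁿ/n!)(eᵗ + 1) = 2` (eq. (2) at `x = 0`), hence
  `Eₙ(0) = Gˢ_{n+1}/(n+1) = 2(1 − 2^{n+1})B_{n+1}/(n+1)` (Hoffman (11), Bernoulli form), `Eₙ(1) = −Eₙ(0)` (`n ≥ 1`),
  `Eₙ(0) = 0` for even `n ≥ 2` and ★ `Eₙ(0) = (−1)^{(n+1)/2} 2^{−n} Pₙ(0)` for odd `n` ((11)).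
* §2 ★ at `x = ½`: `(Σ Eₙ(½)tⁿ/n!)(eᵗ + 1) = 2e^{t/2}` and `Σ Eₙ(½)tⁿ/n! = sech(t/2)`, so ★ `2ⁿEₙ(½) = Eₙ` (the
  signed Euler numbers of `EulerNumbersHyperbolicSecant`), ★ (10): `Eₙ(½) = 0` (`n` odd), `E_{2m}(½) = (−1)ᵐ2^{−2m}Q_{2m}(0)`,
  and «hence `Qₙ(0) = |Eₙ|`».
-/

namespace Literature.Combinatorics.Enumerative
namespace EulerPolynomialValues

open PowerSeries Finset
open scoped Nat
open Literature.Algebra.Polynomial (eulerPolynomial eulerPolynomial_eval_add eulerPolynomial_eval_add_one_add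
  eulerPolynomial_zero)
open Literature.ComputerArithmetic.BrentZimmermann2010 DerivativePolynomials Genocchi SignedEuler

/-! ### §1 `x = 0`: Genocchi, Bernoulli and tangent numbers -/

/-- `eᵗ` as an e.g.f. with all coefficients `1`. [folklore] -/
private theorem exp_eq_mk : exp ℚ = PowerSeries.mk fun j => (1 : ℚ) / (j ! : ℚ) := by
  ext j; simp [coeff_exp]

/-- `e^{at}` as an e.g.f. [folklore] -/
private theorem rescale_exp_eq_mk (a : ℚ) : rescale a (exp ℚ) = PowerSeries.mk fun j => a ^ j / (j ! : ℚ) := by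
  ext j; simp [coeff_exp, coeff_rescale, div_eq_mul_inv]

/-- `eᵗ + 1` is not a zero divisor. [folklore] -/
private theorem exp_add_one_ne_zero : exp ℚ + 1 ≠ 0 := fun h => by
  have h1 := congrArg (PowerSeries.coeff 1) h
  rw [map_add, coeff_exp, PowerSeries.coeff_one, if_neg one_ne_zero, map_zero] at h1
  norm_num at h1

/-- The Appell property as an e.g.f. identity: `Σ Eₙ(x)tⁿ/n! = e^{xt}·Σ Eₙ(0)tⁿ/n!`.
[cite: Hoffman1999DerivativePolynomials, §1 eq. (2) («2e^{xt}/(eᵗ+1) = Σ Eₙ(x)tⁿ/n!»)] -/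
theorem egf_eval (x : ℚ) : (PowerSeries.mk fun n => (eulerPolynomial ℚ n).eval x / (n ! : ℚ)) =
    rescale x (exp ℚ) * PowerSeries.mk fun n => (eulerPolynomial ℚ n).eval 0 / (n ! : ℚ) := by
  ext n
  rw [PowerSeries.coeff_mk, rescale_exp_eq_mk, coeff_egf_mul, ← add_zero x, eulerPolynomial_eval_add, add_zero]

/-- ★ **Eq. (2) at `x = 0`: `(Σ Eₙ(0)tⁿ/n!)·(eᵗ + 1) = 2`**, i.e. `Σ Eₙ(0)tⁿ/n! = 2/(eᵗ+1)`.
[cite: Hoffman1999DerivativePolynomials, §1 eq. (2)] -/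
theorem egf_eval_zero_mul : (PowerSeries.mk fun n => (eulerPolynomial ℚ n).eval 0 / (n ! : ℚ)) * (exp ℚ + 1) = 2 := by
  ext n
  have h1 := PowerSeries.ext_iff.1 (egf_eval (1 : ℚ)) n
  rw [PowerSeries.coeff_mk, rescale_one, RingHom.id_apply] at h1
  rw [mul_add, mul_one, map_add, mul_comm, h1.symm, PowerSeries.coeff_mk, ← add_div, ← zero_add (1 : ℚ),
    eulerPolynomial_eval_add_one_add, show (2 : ℚ⟦X⟧) = PowerSeries.C (2 : ℚ) by rw [map_ofNat], PowerSeries.coeff_C]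
  rcases Nat.eq_zero_or_pos n with rfl | hn
  · simp
  · rw [zero_pow (by omega), mul_zero, zero_div, if_neg (by omega)]

/-- ★ `Σ Gˢ_{n+1}/(n+1)·tⁿ/n!` satisfies the same equation: `G(t)/t·(1 + eᵗ) = 2`.
[cite: Charalambides2018, Ch. 14, Exercise 20 («G(t) = 2t/(1+eᵗ)»)] -/
theorem genocchi_egf_div_X_mul : (PowerSeries.mk fun n => genocchiSigned (n + 1) / ((n + 1 : ℕ) : ℚ) / (n ! : ℚ)) *
    (exp ℚ + 1) = 2 := by
  have hG := genocchiSigned_egf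
  have hX : (PowerSeries.mk fun n => genocchiSigned n / (n ! : ℚ)) =
      X * PowerSeries.mk fun n => genocchiSigned (n + 1) / ((n + 1 : ℕ) : ℚ) / (n ! : ℚ) := by
    ext n
    cases n with
    | zero => simp [genocchiSigned]
    | succ k =>
        rw [PowerSeries.coeff_mk, PowerSeries.coeff_succ_X_mul, PowerSeries.coeff_mk, Nat.factorial_succ, div_div]
        push_cast
        ring
  rw [hX, mul_assoc, add_comm (1 : ℚ⟦X⟧), mul_comm (2 : ℚ⟦X⟧)] at hG
  exact mul_left_cancel₀ X_ne_zero hG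

/-- ★★ **`Eₙ(0) = Gˢ_{n+1}/(n+1)`** (signed Genocchi numbers). [cite: Hoffman1999DerivativePolynomials, §6 (11); Charalambides2018, Ch. 14, Exercise 20] -/
theorem eval_zero_eq_genocchiSigned (n : ℕ) :
    (eulerPolynomial ℚ n).eval 0 = genocchiSigned (n + 1) / ((n + 1 : ℕ) : ℚ) := by
  have h := egf_eval_zero_mul.trans genocchi_egf_div_X_mul.symm
  have h' := PowerSeries.ext_iff.1 (mul_right_cancel₀ exp_add_one_ne_zero h) n
  rw [PowerSeries.coeff_mk, PowerSeries.coeff_mk] at h'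
  have hf : (n ! : ℚ) ≠ 0 := Nat.cast_ne_zero.2 (Nat.factorial_ne_zero n)
  have hn : ((n + 1 : ℕ) : ℚ) ≠ 0 := Nat.cast_ne_zero.2 (Nat.succ_ne_zero n)
  field_simp at h'
  rw [eq_div_iff hn]
  linear_combination h'

/-- ★★ **Hoffman (11), Bernoulli form: `Eₙ(0) = −2(2^{n+1} − 1)B_{n+1}/(n+1)`.**
[cite: Hoffman1999DerivativePolynomials, §6 (11) («this can be written in terms of Bernoulli numbers (see [1], 23.1.20) as −2(2^{n+1} − 1)B_{n+1}/(n+1)»)] -/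
theorem eval_zero_eq_bernoulli (n : ℕ) :
    (eulerPolynomial ℚ n).eval 0 = -2 * (2 ^ (n + 1) - 1) * bernoulli (n + 1) / ((n + 1 : ℕ) : ℚ) := by
  rw [eval_zero_eq_genocchiSigned, genocchiSigned]; ring

/-- `Eₙ(1) = −Eₙ(0)` for `n ≥ 1`. [cite: Hoffman1999DerivativePolynomials, §6 (11) («Eₙ(0) = −Eₙ(1)»)] -/
theorem eval_one_eq_neg {n : ℕ} (hn : 1 ≤ n) : (eulerPolynomial ℚ n).eval 1 = -(eulerPolynomial ℚ n).eval 0 := by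
  have h := eulerPolynomial_eval_add_one_add ℚ n 0
  rw [zero_add, zero_pow (by omega), mul_zero] at h
  linear_combination h

/-- `Eₙ(0) = 0` for even `n ≥ 2`. [cite: Hoffman1999DerivativePolynomials, §6 (11) («0, n even»)] -/
theorem eval_zero_of_even {n : ℕ} (hn : 1 ≤ n) (he : Even n) : (eulerPolynomial ℚ n).eval 0 = 0 := by
  obtain ⟨m, rfl⟩ := he
  rw [eval_zero_eq_genocchiSigned, show m + m + 1 = 2 * m + 1 by ring, genocchiSigned_odd (by omega), zero_div]

/-- ★★ **Hoffman (11): `Eₙ(0) = (−1)^{(n+1)/2}·2^{−n}·Pₙ(0)`** for odd `n` (`Pₙ(0)` the tangent number).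
[cite: Hoffman1999DerivativePolynomials, §6 (11)] -/
theorem eval_zero_of_odd {n : ℕ} (ho : Odd n) :
    (eulerPolynomial ℚ n).eval 0 = (-1) ^ ((n + 1) / 2) * (((TangentNumbers.P n).eval 0 : ℕ) : ℚ) / 2 ^ n := by
  obtain ⟨k, rfl⟩ := ho
  have hm : 1 ≤ k + 1 := by omega
  have hG := neg_one_pow_mul_genocchiSigned hm
  rw [eval_zero_eq_genocchiSigned, eval_zero_P, if_neg (Nat.not_even_iff_odd.2 ⟨k, rfl⟩),
    show (2 * k + 1 + 1) / 2 = k + 1 by omega, show 2 * k + 1 + 1 = 2 * (k + 1) by ring,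
    show genocchiSigned (2 * (k + 1)) = (-1 : ℚ) ^ (k + 1) * ((-1) ^ (k + 1) * genocchiSigned (2 * (k + 1))) by
      rw [← mul_assoc, ← pow_add, ← two_mul, pow_mul, neg_one_sq, one_pow, one_mul], hG, Nat.add_sub_cancel,
    show 2 * (k + 1) - 1 = 2 * k + 1 by omega, pow_succ]
  push_cast
  field_simp
  ring

/-! ### §2 `x = ½`: the Euler numbers `Eₙ = 2ⁿEₙ(½)` -/

/-- ★ **Eq. (2) at `x = ½`: `(Σ Eₙ(½)tⁿ/n!)·(eᵗ + 1) = 2e^{t/2}`.** [cite: Hoffman1999DerivativePolynomials, §1 eq. (2), §6] -/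
theorem egf_eval_half_mul :
    (PowerSeries.mk fun n => (eulerPolynomial ℚ n).eval 2⁻¹ / (n ! : ℚ)) * (exp ℚ + 1) = 2 * rescale (2⁻¹ : ℚ) (exp ℚ) := by
  rw [egf_eval, mul_assoc, egf_eval_zero_mul, mul_comm]

/-- ★★ **`Σ Eₙ(½)tⁿ/n! = sech(t/2)`** (`2e^{t/2}/(eᵗ+1) = 1/cosh(t/2)`). [cite: Hoffman1999DerivativePolynomials, §6 («the Euler numbers are Eₙ = 2ⁿEₙ(½)»); Charalambides2018, Ch. 14, Exercise 18] -/
theorem egf_eval_half_eq : (PowerSeries.mk fun n => (eulerPolynomial ℚ n).eval 2⁻¹ / (n ! : ℚ)) =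
    rescale (2⁻¹ : ℚ) sechSeries := by
  have hS := congrArg (rescale (2⁻¹ : ℚ)) sechSeries_mul
  simp only [map_mul, map_add, map_one, map_ofNat] at hS
  rw [rescale_rescale, mul_inv_cancel₀ (two_ne_zero' ℚ), rescale_one, RingHom.id_apply, add_comm] at hS
  exact mul_right_cancel₀ exp_add_one_ne_zero (egf_eval_half_mul.trans hS.symm)

/-- ★★ **`Eₙ = 2ⁿEₙ(½)`**: the Euler numbers of Abramowitz–Stegun/Hoffman are the signed Euler numbers `n![tⁿ] sech t`.
[cite: Hoffman1999DerivativePolynomials, §6 («the Euler numbers are Eₙ = 2ⁿEₙ(½)»)] -/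
theorem two_pow_mul_eval_half (n : ℕ) : 2 ^ n * (eulerPolynomial ℚ n).eval 2⁻¹ = signedEuler n := by
  have h := PowerSeries.ext_iff.1 egf_eval_half_eq n
  rw [PowerSeries.coeff_mk, coeff_rescale] at h
  have hf : (n ! : ℚ) ≠ 0 := Nat.cast_ne_zero.2 (Nat.factorial_ne_zero n)
  have h2 : (2 : ℚ) ^ n ≠ 0 := pow_ne_zero n two_ne_zero
  rw [div_eq_iff hf, inv_pow] at h
  rw [signedEuler, h]
  field_simp

/-- ★★ **Hoffman (10), odd case: `Eₙ(½) = 0` for odd `n`.** [cite: Hoffman1999DerivativePolynomials, §6 (10)] -/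
theorem eval_half_of_odd {n : ℕ} (ho : Odd n) : (eulerPolynomial ℚ n).eval 2⁻¹ = 0 := by
  obtain ⟨k, rfl⟩ := ho
  have h := two_pow_mul_eval_half (2 * k + 1)
  rw [signedEuler_odd] at h
  exact (mul_eq_zero.1 h).resolve_left (pow_ne_zero _ two_ne_zero)

/-- ★★ **Hoffman (10), even case: `E_{2m}(½) = (−1)ᵐ·2^{−2m}·Q_{2m}(0)`** (`Q_{2m}(0)` the secant number).
[cite: Hoffman1999DerivativePolynomials, §6 (10) («(−1)^{n/2}2^{−n}Qₙ(0), n even»)] -/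
theorem eval_half_of_even (m : ℕ) : (eulerPolynomial ℚ (2 * m)).eval 2⁻¹ =
    (-1) ^ m * (((TangentNumbers.Q (2 * m)).eval 0 : ℕ) : ℚ) / 2 ^ (2 * m) := by
  have h := two_pow_mul_eval_half (2 * m)
  have hE := neg_one_pow_mul_signedEuler m
  rw [eval_zero_Q, if_pos (even_two_mul m), ← hE, ← mul_assoc, ← pow_add, ← two_mul, pow_mul, neg_one_sq, one_pow,
    one_mul, ← h, mul_div_cancel_left₀ _ (pow_ne_zero _ two_ne_zero)]

/-- ★ **«Hence `Qₙ(0) = |Eₙ|`»** (secant numbers are the absolute values of the Euler numbers).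
[cite: Hoffman1999DerivativePolynomials, §6 (after (10))] -/
theorem eval_zero_Q_eq_abs_signedEuler (n : ℕ) : (((TangentNumbers.Q n).eval 0 : ℕ) : ℚ) = |signedEuler n| := by
  rw [eval_zero_Q]
  rcases Nat.even_or_odd n with he | ho
  · obtain ⟨m, rfl⟩ := he
    rw [if_pos ⟨m, rfl⟩, ← two_mul, show |signedEuler (2 * m)| = |(-1 : ℚ) ^ m * signedEuler (2 * m)| by
      rw [abs_mul, abs_pow, abs_neg, abs_one, one_pow, one_mul], neg_one_pow_mul_signedEuler, Nat.abs_cast]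
  · rw [if_neg (Nat.not_even_iff_odd.2 ho)]
    obtain ⟨k, rfl⟩ := ho
    rw [signedEuler_odd, abs_zero, Nat.cast_zero]

end EulerPolynomialValues
end Literature.Combinatorics.Enumerative
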